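import Literature.MathematicalPhysics.QuantumFieldTheory.Balaban1983to89.Node00.CarriersY
import Literature.MathematicalPhysics.QuantumFieldTheory.Balaban1983to89.B9Thm313Whole
import Literature.MathematicalPhysics.QuantumFieldTheory.Balaban1983to89.B9GeoLemma21KLevelV1
import Literature.MathematicalPhysics.QuantumFieldTheory.Balaban1983to89.B9GeoNormsKLevelModelSignsV1

/-!
# BalabanUVNodes ∕ N06 ([B9], `Dag.B9_main`) — OBLIGATIONS OF THE STAGE-11 CERTIFICATE KNIT AT THE RECORD, XI-c:
# rows 20 (`t312`, Theorem 3.12) and 21 (`t313`, Theorem 3.13) AS LEMMAS AT THE RECORD, from seat n06-l's `thm312Printed_of_step` ∕ `thm313Printed_of_step` at the predicate pins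

Track A of `YM-PLAN.md` (cell `pub-ymgap`, HUMAN RULING D-0062), node **N06** = [Balaban1985BackgroundPropagators] Thms 3.1–3.15; seat
`pub-ymgap-dag-n06-d` gen 2 = dag-lead N06-ASSIGNMENT v1 (P3) «THE KNIT AT THE RECORD».  Companion of `…ObligationsPins` ∕ `…Pins2` (per-row lemmas at `ops : OpsY N θ₃ M⋆`).

ROW 20 AND ITS SUPPLIER.  Seat n06-l's `B9Thm312WholeLeaf.thm312Printed_of_step` (p467704) inhabits the typed leaf `B9.Thm312Printed d c35 geo bg GD G₁ Hk H₁k HasRWExp HasRWExpH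
PosDefK` AT THE PINS `HasRWExpOfOps (𝔬 i)`, `HasRWExpHOfOps (𝔬 i)`, `PosDefKOfOps (𝔬 i)` of one letter record `𝔬 i : B9Thm312Whole.Ops` per member, from: the geometry facts
`GeoOK`, the model signs, a generic row sum `RowSum (toB6 …) σ c` for M ≧ M_L, the co-readings of `GD`, `G₁` (n = 0, 2), the per-U hypotheses `hmodel` (Thm 3.3 for G₀, the
two (3.131)∕(3.138) steps, the smallness of the forms, the identities (3.130)) and the displayed residual `hres` of the two kernel families and the two H-kernels.  AT THE
RECORD (`I := MemberY`, `geo9Y`, `bg9Y (M_N ℂ) SU(N)`, `c35Y`, `d := d₆ + 1`) the geometry facts ARE THEOREMS (n06-i's `B9GeoLemma21KLevelV1`: `geo9Y_dist_triangle`,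
`geo9Y_dist_comm`, `geo9Y_len_pos`; `B9GeoNormsKLevelV1.geo9K_dist_nonneg`), the signs are dag-n03-b's `modelSignsOn_geo9K`, and the row sum at EVERY rate σ > 0 is n06-i's
`rowSum261_geo9Y` — so they are DISCHARGED here; the three predicate slots of the layer are PINNED literally (`funext`).

WHAT THIS MODULE DOES (kernel bookkeeping; 0 `def`, 0 `sorry`, standard axioms; COUNT-NEUTRAL, `--supports` K1 `StabilityBAtRecordR11e`):
* `geoOK_geo9Y` — `B9Thm312Whole.GeoOK (geo9Y x)` at every member (from n06-i's distance facts).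
* `t312_of_pins` — `B9.Thm312Printed (θ₃.d₆+1) c35Y geo9Y (bg9Y …) (fun x => (ops x).GD) (fun x => (ops x).G₁) (fun x => (ops x).H) (fun x => (ops x).H₁) (fun x => (ops x).HasRWExp)
  (fun x => (ops x).HasRWExpH) (fun x => (ops x).PosDefK)` — the certificate's binder `t312` VERBATIM — from n06-l's inputs with `hgeo`, `S`, `hrow`, `hc` discharged.
* `t313_of_pins` — `B9.Thm313Printed c35Y geo9Y (bg9Y …) (fun x => (ops x).GG) (fun x => (ops x).HasRWExp) (fun x => (ops x).PosDefK)` — the binder `t313` VERBATIM — from n06-l's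
  `B9Thm313Whole.thm313Printed_of_step` (p469293: the SAME letter record and `hmodel` as row 20 + the ten printed-shape letters `Letters313` between the state norms + the
  residual of 𝔊), `hgeo`, `S`, `hrow` (rate σ > 0), `hc` discharged, the two predicate slots pinned.

HONEST FRAMING.  Kernel bookkeeping at pinned readings; nothing of [B9] is proved for Bałaban's operators; N06 is NOT discharged.  One finite four-torus programme at fixed
`ε` — NOT ℝ⁴, NOT OS, NOT a mass gap, NOT Clay.  No `def`.
-/

noncomputable section

namespace Summit.QuantumFields.YangMills.BalabanUVNodes.N06AtRecord11ObligationsPins3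

open Literature.MathematicalPhysics.QuantumFieldTheory.Balaban1983to89
open Literature.MathematicalPhysics.QuantumFieldTheory.Balaban1983to89.Node00
open Literature.MathematicalPhysics.QuantumFieldTheory.Balaban1983to89.B9PinMembersKLevelV1 (MemberY geo9Y bg9Y)
open Literature.MathematicalPhysics.QuantumFieldTheory.Balaban1983to89.B9PinGeometryKLevelV1 (c35Y)
open Literature.MathematicalPhysics.QuantumFieldTheory.Balaban1983to89.B7Prop2SpecialUnitary (specialUnitaryUnits)
open Literature.MathematicalPhysics.QuantumFieldTheory.Balaban1983to89.B9Thm34Ext (toB6)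
open Literature.MathematicalPhysics.QuantumFieldTheory.Balaban1983to89.B11SectG (RowSum)
open Literature.MathematicalPhysics.QuantumFieldTheory.Balaban1983to89.B9Thm37GlueCor36 (CoRealizes Clause342)
open Literature.MathematicalPhysics.QuantumFieldTheory.Balaban1983to89.B9FromB6 (L2Block)
open Literature.MathematicalPhysics.QuantumFieldTheory.Balaban1983to89.B9Thm312Whole
  (Ops GeoOK Thm33G0 FormSmall HasRWExpOfOps HasRWExpHOfOps PosDefKOfOps)
open Literature.MathematicalPhysics.QuantumFieldTheory.Balaban1983to89.B9Thm312WholeLeaf (thm312Printed_of_step)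
open Literature.MathematicalPhysics.QuantumFieldTheory.Balaban1983to89.B9Thm313Whole (Letters313 thm313Printed_of_step)
open Literature.MathematicalPhysics.QuantumFieldTheory.Balaban1983to89.B9GeoLemma21KLevelV1 (geo9Y_dist_triangle geo9Y_dist_comm geo9Y_len_pos rowSum261_geo9Y)
open Literature.MathematicalPhysics.QuantumFieldTheory.Balaban1983to89.B9GeoNormsKLevelV1 (geo9K_dist_nonneg)
open Literature.MathematicalPhysics.QuantumFieldTheory.Balaban1983to89.B9GeoNormsKLevelModelSignsV1 (modelSignsOn_geo9K)
open scoped Matrix.Norms.L2Operator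

variable {N : ℕ} (θ₃ : Stage3Params) (Mstar : ℕ) (ops : OpsY N θ₃ Mstar)

/-- **`GeoOK (geo9Y x)` IS A THEOREM** of the record's k-level tori: (2.54), symmetry, `d ≥ 0`, `Lʲη > 0` (n06-i's `B9GeoLemma21KLevelV1`, dag-n03-b's `geo9K_dist_nonneg`).
[cite: Balaban1984PropagatorsII, (2.46) p.231, (2.54) p.233] -/
theorem geoOK_geo9Y (x : MemberY θ₃.d₆ θ₃.ℓ₆ θ₃.hd' θ₃.hL' θ₃.b₀ θ₃.b₁ Mstar) : GeoOK (geo9Y x) :=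
  ⟨geo9Y_dist_triangle x, geo9Y_dist_comm x, geo9K_dist_nonneg x.toKIdx, geo9Y_len_pos x⟩

/-- ★ **ROW 20 `t312` AT THE RECORD FROM n06-l's LEAF** (Thm 3.12 pp. 421–423 at the pins): with the layer's three predicate slots PINNED to the letters
(`(ops x).HasRWExp = HasRWExpOfOps (𝔬 x)`, `(ops x).HasRWExpH = HasRWExpHOfOps (𝔬 x)`, `(ops x).PosDefK = PosDefKOfOps (𝔬 x)`) and the readings `GD`, `G₁`, `H`, `H₁` of the
layer passed as they are, n06-l's inputs — co-readings, `hmodel` (Thm 3.3 for G₀, the (3.131)∕(3.138) steps with θ = θ₁·Mα₀, the smallness of the forms with r = r₁·Mα₀, the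
identities), the displayed residual `hres` — give `B9.Thm312Printed (θ₃.d₆+1) c35Y geo9Y (bg9Y …) …`, the certificate's binder verbatim.  DISCHARGED here: `GeoOK` (`geoOK_geo9Y`),
the model signs (`modelSignsOn_geo9K`), the generic row sum at the rate σ > 0 for M ≧ M_L (`rowSum261_geo9Y`, constant floored at 0).
[cite: Balaban1985BackgroundPropagators, Thm 3.12 (3.130)–(3.138) pp.421–423, Thm 3.3 p.399; Balaban1984PropagatorsII, Lemma 2.1 (2.61) p.234] -/
theorem t312_of_pins [∀ x : MemberY θ₃.d₆ θ₃.ℓ₆ θ₃.hd' θ₃.hL' θ₃.b₀ θ₃.b₁ Mstar, Fintype (geo9Y x).Site]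
    {X Y Z W : MemberY θ₃.d₆ θ₃.ℓ₆ θ₃.hd' θ₃.hL' θ₃.b₀ θ₃.b₁ Mstar → Type} [∀ x, Fintype (X x)] [∀ x, DecidableEq (X x)] [∀ x, Fintype (Y x)] [∀ x, Fintype (Z x)] [∀ x, Fintype (W x)]
    (𝔬 : ∀ x : MemberY θ₃.d₆ θ₃.ℓ₆ θ₃.hd' θ₃.hL' θ₃.b₀ θ₃.b₁ Mstar, Ops (geo9Y x) (bg9Y (Matrix (Fin N) (Fin N) ℂ) (specialUnitaryUnits (Fin N)) x) (X x) (Y x) (Z x) (W x)) (R₀ : MemberY θ₃.d₆ θ₃.ℓ₆ θ₃.hd' θ₃.hL' θ₃.b₀ θ₃.b₁ Mstar → ℝ) (H₀ : MemberY θ₃.d₆ θ₃.ℓ₆ θ₃.hd' θ₃.hL' θ₃.b₀ θ₃.b₁ Mstar → Prop)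
    (ev : ∀ x : MemberY θ₃.d₆ θ₃.ℓ₆ θ₃.hd' θ₃.hL' θ₃.b₀ θ₃.b₁ Mstar, (geo9Y x).Loc → X x → ℝ) (evY : ∀ x : MemberY θ₃.d₆ θ₃.ℓ₆ θ₃.hd' θ₃.hL' θ₃.b₀ θ₃.b₁ Mstar, (geo9Y x).Loc → Y x → ℝ)
    (θ₁ r₁ B₀ δ₀ δK σ ρ a₁ M₁ B₁ δ₁ : ℝ) (Bβ Bε : ℝ → ℝ) (Bεβ : ℝ → ℝ → ℝ)
    (hθ₁ : 0 ≤ θ₁) (hr₁ : 0 ≤ r₁) (hB₀ : 0 ≤ B₀) (hρ : 0 < ρ) (hρS : ρ ≤ δ₀) (hρδ : ρ + σ ≤ δK) (hσ : 0 < σ)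
    (ha₁ : 0 < a₁) (hM₁ : 0 < M₁) (hB₁ : 0 ≤ B₁) (hδ₁ : 0 < δ₁) (hBβ : ∀ β, 0 ≤ Bβ β) (hBε : ∀ ε, 0 ≤ Bε ε) (hBεβ : ∀ ε β, 0 ≤ Bεβ ε β)
    (hco : ∀ (x : MemberY θ₃.d₆ θ₃.ℓ₆ θ₃.hd' θ₃.hL' θ₃.b₀ θ₃.b₁ Mstar) (U : (bg9Y (Matrix (Fin N) (Fin N) ℂ) (specialUnitaryUnits (Fin N)) x).Cfg),
      CoRealizes (ops x).GD 0 U (𝔬 x).blk (𝔬 x).blk (ev x) ((𝔬 x).G U) ∧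
      CoRealizes (ops x).GD 2 U (𝔬 x).blk (𝔬 x).blkY (evY x) ((𝔬 x).G U ∘ₗ (𝔬 x).Dstar U) ∧
      CoRealizes (ops x).G₁ 0 U (𝔬 x).blk (𝔬 x).blk (ev x) ((𝔬 x).G1 U) ∧
      CoRealizes (ops x).G₁ 2 U (𝔬 x).blk (𝔬 x).blkY (evY x) ((𝔬 x).G1 U ∘ₗ (𝔬 x).Dstar U))
    (hmodel : ∀ x : MemberY θ₃.d₆ θ₃.ℓ₆ θ₃.hd' θ₃.hL' θ₃.b₀ θ₃.b₁ Mstar, M₁ ≤ (geo9Y x).M → ∀ α₀ : ℝ, 0 < α₀ → (geo9Y x).M * α₀ ≤ a₁ →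
      ∀ U : (bg9Y (Matrix (Fin N) (Fin N) ℂ) (specialUnitaryUnits (Fin N)) x).Cfg, (bg9Y (Matrix (Fin N) (Fin N) ℂ) (specialUnitaryUnits (Fin N)) x).Reg335 c35Y α₀ U → (bg9Y (Matrix (Fin N) (Fin N) ℂ) (specialUnitaryUnits (Fin N)) x).Reg336 c35Y α₀ U →
        Thm33G0 (𝔬 x) (R₀ x) (H₀ x) B₀ δ₀ U ∧
        B9Thm312Whole.Step (𝔬 x) (R₀ x) (H₀ x) (geoOK_geo9Y θ₃ Mstar x).lenle 1 (θ₁ * ((geo9Y x).M * α₀)) δK U ∧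
        B9Thm312Whole.Step (𝔬 x) (R₀ x) (H₀ x) (geoOK_geo9Y θ₃ Mstar x).lenle 2 (θ₁ * ((geo9Y x).M * α₀)) δK U ∧
        FormSmall (𝔬 x) (r₁ * ((geo9Y x).M * α₀)) U ∧ B9Thm312Whole.Identities (𝔬 x) U)
    (hres : ∀ x : MemberY θ₃.d₆ θ₃.ℓ₆ θ₃.hd' θ₃.hL' θ₃.b₀ θ₃.b₁ Mstar, M₁ ≤ (geo9Y x).M → ∀ α₀ : ℝ, 0 < α₀ → (geo9Y x).M * α₀ ≤ a₁ →
      ∀ U : (bg9Y (Matrix (Fin N) (Fin N) ℂ) (specialUnitaryUnits (Fin N)) x).Cfg, (bg9Y (Matrix (Fin N) (Fin N) ℂ) (specialUnitaryUnits (Fin N)) x).Reg335 c35Y α₀ U → (bg9Y (Matrix (Fin N) (Fin N) ℂ) (specialUnitaryUnits (Fin N)) x).Reg336 c35Y α₀ U →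
        (∀ K ∈ [(ops x).GD, (ops x).G₁], Clause342 K 1 B₁ δ₁ U ∧ L2Block K B₁ δ₁ U ∧
          (∀ (n : Fin 4) (lam : (geo9Y x).Loc) (γ : ℝ), n ≠ 3 → -4 ≤ γ → γ ≤ 4 →
            K.glob n U lam γ ≤ B₁ * (geo9Y x).wNorm γ lam) ∧
          B9.Ineq343_345 K Bβ Bε Bεβ δ₁ U) ∧
        (∀ Hk' ∈ [(ops x).H, (ops x).H₁], B9.Ineq3133 (θ₃.d₆ + 1) Hk' B₁ Bβ δ₁ U))
    (hpinE : ∀ x : MemberY θ₃.d₆ θ₃.ℓ₆ θ₃.hd' θ₃.hL' θ₃.b₀ θ₃.b₁ Mstar, (ops x).HasRWExp = HasRWExpOfOps (𝔬 x)) (hpinH : ∀ x : MemberY θ₃.d₆ θ₃.ℓ₆ θ₃.hd' θ₃.hL' θ₃.b₀ θ₃.b₁ Mstar, (ops x).HasRWExpH = HasRWExpHOfOps (𝔬 x))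
    (hpinK : ∀ x : MemberY θ₃.d₆ θ₃.ℓ₆ θ₃.hd' θ₃.hL' θ₃.b₀ θ₃.b₁ Mstar, (ops x).PosDefK = PosDefKOfOps (𝔬 x)) :
    B9.Thm312Printed (θ₃.d₆ + 1) c35Y geo9Y (bg9Y (Matrix (Fin N) (Fin N) ℂ) (specialUnitaryUnits (Fin N))) (fun x => (ops x).GD) (fun x => (ops x).G₁) (fun x => (ops x).H)
      (fun x => (ops x).H₁) (fun x => (ops x).HasRWExp) (fun x => (ops x).HasRWExpH) (fun x => (ops x).PosDefK) := by
  have hE : (fun x => (ops x).HasRWExp) = fun x => HasRWExpOfOps (𝔬 x) := funext hpinE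
  have hH : (fun x => (ops x).HasRWExpH) = fun x => HasRWExpHOfOps (𝔬 x) := funext hpinH
  have hK : (fun x => (ops x).PosDefK) = fun x => PosDefKOfOps (𝔬 x) := funext hpinK
  rw [hE, hH, hK]
  obtain ⟨ML, c, hrow⟩ := rowSum261_geo9Y (d := θ₃.d₆) (ℓ := θ₃.ℓ₆) (hd := θ₃.hd') (hL := θ₃.hL') (b₀ := θ₃.b₀) (b₁ := θ₃.b₁) (Mstar := Mstar) σ hσ
  exact thm312Printed_of_step 𝔬 R₀ H₀ (fun x => (ops x).GD) (fun x => (ops x).G₁) (fun x => (ops x).H) (fun x => (ops x).H₁) ev evY θ₁ r₁ B₀ δ₀ δK σ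
    (max c 0) ρ a₁ M₁ ML B₁ δ₁ Bβ Bε Bεβ hθ₁ hr₁ hB₀ hρ hρS hρδ (le_max_right _ _) ha₁ hM₁ hB₁ hδ₁ hBβ hBε hBεβ (fun x => geoOK_geo9Y θ₃ Mstar x)
    (fun x => modelSignsOn_geo9K x.toKIdx) (fun x hM y => (hrow x hM y).trans (le_max_left _ _)) hco hmodel hres

/-- ★ **ROW 21 `t313` AT THE RECORD FROM n06-l's LEAF** (Thm 3.13 pp. 424–425 at the pins): the SAME letter record `𝔬` and per-U model hypotheses `hmodel` as row 20, the co-readings of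
`(ops x).GG` (n = 0, 2), the ten printed-shape letters `Letters313` between the state norms, the displayed residual of 𝔊 ((3.42)₂, L², (3.47)ₙ≠₃, (3.43)–(3.45)), and the two
predicate pins `(ops x).HasRWExp = HasRWExpOfOps (𝔬 x)`, `(ops x).PosDefK = PosDefKOfOps (𝔬 x)` give `B9.Thm313Printed c35Y geo9Y (bg9Y …) (fun x => (ops x).GG) …`, the
certificate's binder verbatim.  DISCHARGED here: `GeoOK`, the model signs, the generic row sum at the rate σ > 0 (constant floored at 0).
[cite: Balaban1985BackgroundPropagators, Thm 3.13 (3.150)–(3.153) pp.424–425, Thm 3.12 pp.421–423; Balaban1984PropagatorsII, Lemma 2.1 (2.61) p.234] -/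
theorem t313_of_pins [∀ x : MemberY θ₃.d₆ θ₃.ℓ₆ θ₃.hd' θ₃.hL' θ₃.b₀ θ₃.b₁ Mstar, Fintype (geo9Y x).Site]
    {X Y Z W : MemberY θ₃.d₆ θ₃.ℓ₆ θ₃.hd' θ₃.hL' θ₃.b₀ θ₃.b₁ Mstar → Type} [∀ x, Fintype (X x)] [∀ x, DecidableEq (X x)] [∀ x, Fintype (Y x)] [∀ x, Fintype (Z x)] [∀ x, Fintype (W x)]
    (𝔬 : ∀ x : MemberY θ₃.d₆ θ₃.ℓ₆ θ₃.hd' θ₃.hL' θ₃.b₀ θ₃.b₁ Mstar, Ops (geo9Y x) (bg9Y (Matrix (Fin N) (Fin N) ℂ) (specialUnitaryUnits (Fin N)) x) (X x) (Y x) (Z x) (W x)) (R₀ : MemberY θ₃.d₆ θ₃.ℓ₆ θ₃.hd' θ₃.hL' θ₃.b₀ θ₃.b₁ Mstar → ℝ) (H₀ : MemberY θ₃.d₆ θ₃.ℓ₆ θ₃.hd' θ₃.hL' θ₃.b₀ θ₃.b₁ Mstar → Prop)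
    (ev : ∀ x : MemberY θ₃.d₆ θ₃.ℓ₆ θ₃.hd' θ₃.hL' θ₃.b₀ θ₃.b₁ Mstar, (geo9Y x).Loc → X x → ℝ) (evY : ∀ x : MemberY θ₃.d₆ θ₃.ℓ₆ θ₃.hd' θ₃.hL' θ₃.b₀ θ₃.b₁ Mstar, (geo9Y x).Loc → Y x → ℝ)
    (θ₁ r₁ B₀ δ₀ δK σ ρ a₁ M₁ B₁ δ₁ B₃ δ₃ ρ' : ℝ) (Bβ Bε : ℝ → ℝ) (Bεβ : ℝ → ℝ → ℝ)
    (hθ₁ : 0 ≤ θ₁) (hr₁ : 0 ≤ r₁) (hB₀ : 0 ≤ B₀) (hB₃ : 0 ≤ B₃) (hσ : 0 < σ) (hρ' : 0 < ρ') (hρ'ρ : ρ' + 3 * σ ≤ ρ) (hρS : ρ ≤ δ₀) (hρ₃ : ρ ≤ δ₃)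
    (hρδ : ρ + σ ≤ δK) (ha₁ : 0 < a₁) (hM₁ : 0 < M₁) (hB₁ : 0 ≤ B₁) (hδ₁ : 0 < δ₁) (hBβ : ∀ β, 0 ≤ Bβ β) (hBε : ∀ ε, 0 ≤ Bε ε) (hBεβ : ∀ ε β, 0 ≤ Bεβ ε β)
    (hco : ∀ (x : MemberY θ₃.d₆ θ₃.ℓ₆ θ₃.hd' θ₃.hL' θ₃.b₀ θ₃.b₁ Mstar) (U : (bg9Y (Matrix (Fin N) (Fin N) ℂ) (specialUnitaryUnits (Fin N)) x).Cfg),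
      CoRealizes (ops x).GG 0 U (𝔬 x).blk (𝔬 x).blk (ev x) ((𝔬 x).GG U) ∧
      CoRealizes (ops x).GG 2 U (𝔬 x).blk (𝔬 x).blkY (evY x) ((𝔬 x).GG U ∘ₗ (𝔬 x).Dstar U))
    (hmodel : ∀ x : MemberY θ₃.d₆ θ₃.ℓ₆ θ₃.hd' θ₃.hL' θ₃.b₀ θ₃.b₁ Mstar, M₁ ≤ (geo9Y x).M → ∀ α₀ : ℝ, 0 < α₀ → (geo9Y x).M * α₀ ≤ a₁ →
      ∀ U : (bg9Y (Matrix (Fin N) (Fin N) ℂ) (specialUnitaryUnits (Fin N)) x).Cfg, (bg9Y (Matrix (Fin N) (Fin N) ℂ) (specialUnitaryUnits (Fin N)) x).Reg335 c35Y α₀ U → (bg9Y (Matrix (Fin N) (Fin N) ℂ) (specialUnitaryUnits (Fin N)) x).Reg336 c35Y α₀ U →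
        Thm33G0 (𝔬 x) (R₀ x) (H₀ x) B₀ δ₀ U ∧
        B9Thm312Whole.Step (𝔬 x) (R₀ x) (H₀ x) (geoOK_geo9Y θ₃ Mstar x).lenle 1 (θ₁ * ((geo9Y x).M * α₀)) δK U ∧
        B9Thm312Whole.Step (𝔬 x) (R₀ x) (H₀ x) (geoOK_geo9Y θ₃ Mstar x).lenle 2 (θ₁ * ((geo9Y x).M * α₀)) δK U ∧
        FormSmall (𝔬 x) (r₁ * ((geo9Y x).M * α₀)) U ∧ B9Thm312Whole.Identities (𝔬 x) U)
    (hletters : ∀ x : MemberY θ₃.d₆ θ₃.ℓ₆ θ₃.hd' θ₃.hL' θ₃.b₀ θ₃.b₁ Mstar, M₁ ≤ (geo9Y x).M → ∀ α₀ : ℝ, 0 < α₀ → (geo9Y x).M * α₀ ≤ a₁ →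
      ∀ U : (bg9Y (Matrix (Fin N) (Fin N) ℂ) (specialUnitaryUnits (Fin N)) x).Cfg, (bg9Y (Matrix (Fin N) (Fin N) ℂ) (specialUnitaryUnits (Fin N)) x).Reg335 c35Y α₀ U → (bg9Y (Matrix (Fin N) (Fin N) ℂ) (specialUnitaryUnits (Fin N)) x).Reg336 c35Y α₀ U →
        Letters313 (𝔬 x) (R₀ x) (H₀ x) (geoOK_geo9Y θ₃ Mstar x) B₃ δ₃ U)
    (hres : ∀ x : MemberY θ₃.d₆ θ₃.ℓ₆ θ₃.hd' θ₃.hL' θ₃.b₀ θ₃.b₁ Mstar, M₁ ≤ (geo9Y x).M → ∀ α₀ : ℝ, 0 < α₀ → (geo9Y x).M * α₀ ≤ a₁ →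
      ∀ U : (bg9Y (Matrix (Fin N) (Fin N) ℂ) (specialUnitaryUnits (Fin N)) x).Cfg, (bg9Y (Matrix (Fin N) (Fin N) ℂ) (specialUnitaryUnits (Fin N)) x).Reg335 c35Y α₀ U → (bg9Y (Matrix (Fin N) (Fin N) ℂ) (specialUnitaryUnits (Fin N)) x).Reg336 c35Y α₀ U →
        Clause342 (ops x).GG 1 B₁ δ₁ U ∧ L2Block (ops x).GG B₁ δ₁ U ∧
          (∀ (n : Fin 4) (lam : (geo9Y x).Loc) (γ : ℝ), n ≠ 3 → -4 ≤ γ → γ ≤ 4 →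
            ((ops x).GG).glob n U lam γ ≤ B₁ * (geo9Y x).wNorm γ lam) ∧
          B9.Ineq343_345 (ops x).GG Bβ Bε Bεβ δ₁ U)
    (hpinE : ∀ x : MemberY θ₃.d₆ θ₃.ℓ₆ θ₃.hd' θ₃.hL' θ₃.b₀ θ₃.b₁ Mstar, (ops x).HasRWExp = HasRWExpOfOps (𝔬 x)) (hpinK : ∀ x : MemberY θ₃.d₆ θ₃.ℓ₆ θ₃.hd' θ₃.hL' θ₃.b₀ θ₃.b₁ Mstar, (ops x).PosDefK = PosDefKOfOps (𝔬 x)) :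
    B9.Thm313Printed c35Y geo9Y (bg9Y (Matrix (Fin N) (Fin N) ℂ) (specialUnitaryUnits (Fin N))) (fun x => (ops x).GG) (fun x => (ops x).HasRWExp) (fun x => (ops x).PosDefK) := by
  have hE : (fun x => (ops x).HasRWExp) = fun x => HasRWExpOfOps (𝔬 x) := funext hpinE
  have hK : (fun x => (ops x).PosDefK) = fun x => PosDefKOfOps (𝔬 x) := funext hpinK
  rw [hE, hK]
  obtain ⟨ML, c, hrow⟩ := rowSum261_geo9Y (d := θ₃.d₆) (ℓ := θ₃.ℓ₆) (hd := θ₃.hd') (hL := θ₃.hL') (b₀ := θ₃.b₀) (b₁ := θ₃.b₁) (Mstar := Mstar) σ hσ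
  exact thm313Printed_of_step 𝔬 R₀ H₀ (fun x => (ops x).GG) ev evY θ₁ r₁ B₀ δ₀ δK σ (max c 0) ρ a₁ M₁ ML B₁ δ₁ B₃ δ₃ ρ' Bβ Bε Bεβ hθ₁ hr₁ hB₀ hB₃ hσ.le
    hρ' hρ'ρ hρS hρ₃ hρδ (le_max_right _ _) ha₁ hM₁ hB₁ hδ₁ hBβ hBε hBεβ (fun x => geoOK_geo9Y θ₃ Mstar x) (fun x => modelSignsOn_geo9K x.toKIdx)
    (fun x hM y => (hrow x hM y).trans (le_max_left _ _)) hco hmodel hletters hres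

end Summit.QuantumFields.YangMills.BalabanUVNodes.N06AtRecord11ObligationsPins3

end
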